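import Mathlib
import Summits.NavierStokesRegularity.NavierStokesRegularity.Theorems.LevelSetModerationLevelSetEnergyInequalityTruncation

/-!
# Route LevelSetModeration — crux `LevelSetClosure`: two-level `C¹` truncation of the speed

Support lemma (stub `stub_truncation` of line `Sketch-ideator2`) for item
stmt-NavierStokesRegularity-18150, the PDE-free calculus device fed to the whole-space
Gagliardo–Nirenberg–Sobolev inequality in the De Giorgi iteration for the speed.
Pure calculus on `ℝ³ = EuclideanSpace ℝ (Fin 3)`: for a `C¹` field `v` and levels `0 < k < h`,
the scalar
`w = √(δ² + (|v| - k)₊²) - δ`, `δ = (h - k)/2`,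
is `C¹`, nonnegative, satisfies `w² ≤ (|v| - k)₊²`, `w ≥ (h - k)/4` on `{|v| > h}`, and
`‖Dw‖ ≤ 1_{|v| > k} ‖D|v|‖` pointwise. The `C¹` regularity of `Ψ = (|v| - k)₊²` and its derivative
`DΨ(v) = 2 k₀(v) ⟪v, ·⟫` (`k₀(v) = (|v| - k)₊ / max(|v|, k)`) come from the `Truncation` helper file
of item 18151.
-/

noncomputable section

-- single-conjunct summit: `Summit.<Summit>.<Problem>` repeats the name by the D-0017 layout
set_option linter.dupNamespace false

namespace Summit.NavierStokesRegularity.NavierStokesRegularity.Theorems.LevelSetClosure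

open Real Set Filter Topology
open scoped RealInnerProductSpace
open Summit.NavierStokesRegularity.NavierStokesRegularity.Theorems.LevelSetEnergyInequality

/-! ### Real-variable inequalities for `s ↦ √(δ² + s) - δ` -/

/-- `δ ≤ √(δ² + a)` for `a ≥ 0`. -/
private theorem le_sqrt_sq_add (δ : ℝ) {a : ℝ} (ha : 0 ≤ a) : δ ≤ √(δ ^ 2 + a) :=
  Real.le_sqrt_of_sq_le (by linarith)

/-- `(√(δ² + a) - δ)² ≤ a` for `δ, a ≥ 0`. -/
private theorem sq_sqrt_sq_add_sub_le {δ a : ℝ} (hδ : 0 ≤ δ) (ha : 0 ≤ a) :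
    (√(δ ^ 2 + a) - δ) ^ 2 ≤ a := by
  have hs : √(δ ^ 2 + a) ^ 2 = δ ^ 2 + a := Real.sq_sqrt (by positivity)
  have hle : δ ≤ √(δ ^ 2 + a) := le_sqrt_sq_add δ ha
  nlinarith [mul_nonneg hδ (sub_nonneg.2 hle)]

/-- If `0 < δ` and `2δ < m` then `δ / 2 ≤ √(δ² + m²) - δ`. -/
private theorem half_le_sqrt_sq_add_sub {δ m : ℝ} (hδ : 0 < δ) (hm : 2 * δ < m) :
    δ / 2 ≤ √(δ ^ 2 + m ^ 2) - δ := by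
  have h1 : 3 * δ / 2 ≤ √(δ ^ 2 + m ^ 2) := by
    refine Real.le_sqrt_of_sq_le ?_
    nlinarith [mul_pos (sub_pos.2 hm) (show 0 < m + 2 * δ by linarith)]
  linarith

/-- `m ≤ √(δ² + m²)` for `m ≥ 0`. -/
private theorem le_sqrt_sq_add_sq {δ m : ℝ} (hm : 0 ≤ m) : m ≤ √(δ ^ 2 + m ^ 2) := by
  calc m = √(m ^ 2) := (Real.sqrt_sq hm).symm
    _ ≤ √(δ ^ 2 + m ^ 2) := Real.sqrt_le_sqrt (by nlinarith [sq_nonneg δ])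

/-! ### The truncation `w = √(δ² + (|v| - k)₊²) - δ` on `ℝ³` -/

variable {v : EuclideanSpace ℝ (Fin 3) → EuclideanSpace ℝ (Fin 3)} {k δ : ℝ}

/-- The derivative of `w = √(δ² + (|v| - k)₊²) - δ`:
`Dw(x) = (k₀(v x) / √(δ² + (|v x| - k)₊²)) ⟪v x, Dv(x) ·⟫`. -/
private theorem hasFDerivAt_trunc (hv : ContDiff ℝ 1 v) (hk : 0 < k) (hδ : 0 < δ)
    (x : EuclideanSpace ℝ (Fin 3)) :
    HasFDerivAt (fun y => √(δ ^ 2 + (max (‖v y‖ - k) 0) ^ 2) - δ)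
      ((max (‖v x‖ - k) 0 / max ‖v x‖ k / √(δ ^ 2 + (max (‖v x‖ - k) 0) ^ 2)) •
        (innerSL ℝ (v x)).comp (fderiv ℝ v x)) x := by
  have hvd : HasFDerivAt v (fderiv ℝ v x) x := (hv.differentiable one_ne_zero x).hasFDerivAt
  have hΨ : HasFDerivAt (fun y => (max (‖v y‖ - k) 0) ^ 2)
      ((2 * (max (‖v x‖ - k) 0 / max ‖v x‖ k)) • (innerSL ℝ (v x)).comp (fderiv ℝ v x)) x := by
    have h := (hasFDerivAt_truncSq hk (v x)).comp x hvd
    rwa [ContinuousLinearMap.smul_comp] at h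
  have hg : HasFDerivAt (fun y => δ ^ 2 + (max (‖v y‖ - k) 0) ^ 2)
      ((2 * (max (‖v x‖ - k) 0 / max ‖v x‖ k)) • (innerSL ℝ (v x)).comp (fderiv ℝ v x)) x :=
    hΨ.const_add (δ ^ 2)
  have hpos : 0 < δ ^ 2 + (max (‖v x‖ - k) 0) ^ 2 := by positivity
  have hw := (hg.sqrt hpos.ne').sub_const δ
  rw [smul_smul] at hw
  refine hw.congr_fderiv ?_
  congr 1
  rw [div_mul_eq_mul_div, one_mul, mul_div_mul_left _ _ (two_ne_zero' ℝ)]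

/-- The pointwise derivative bound `‖Dw(x)‖ ≤ 1_{|v| > k}(x) ‖D|v|(x)‖` for
`w = √(δ² + (|v| - k)₊²) - δ`: off `{|v| > k}` the weight `k₀(v x)` vanishes, and on it
`k₀(v x) |v x| = |v x| - k ≤ √(δ² + (|v x| - k)²)` while `D|v|(x) = |v x|⁻¹ ⟪v x, Dv(x) ·⟫`. -/
private theorem norm_fderiv_trunc_le (hv : ContDiff ℝ 1 v) (hk : 0 < k) (hδ : 0 < δ)
    (x : EuclideanSpace ℝ (Fin 3)) :
    ‖fderiv ℝ (fun y => √(δ ^ 2 + (max (‖v y‖ - k) 0) ^ 2) - δ) x‖ ≤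
      Set.indicator {x | k < ‖v x‖} (fun x => ‖fderiv ℝ (fun y => ‖v y‖) x‖) x := by
  rw [(hasFDerivAt_trunc hv hk hδ x).fderiv, norm_smul, Real.norm_eq_abs,
    abs_of_nonneg (div_nonneg (weight_nonneg hk (v x)) (Real.sqrt_nonneg _))]
  rcases le_or_gt ‖v x‖ k with hle | hlt
  · -- off the super-level set the weight vanishes
    rw [weight_eq_zero_of_norm_le (v x) hle, zero_div, zero_mul]
    exact Set.indicator_nonneg (fun y _ => norm_nonneg _) x
  · -- on the super-level set compare with `D|v|(x) = |v x|⁻¹ ⟪v x, Dv(x) ·⟫`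
    have hx0 : v x ≠ 0 := by
      intro h0
      rw [h0, norm_zero] at hlt
      linarith
    have hvpos : 0 < ‖v x‖ := hk.trans hlt
    have hvd : HasFDerivAt v (fderiv ℝ v x) x := (hv.differentiable one_ne_zero x).hasFDerivAt
    have hN : HasFDerivAt (fun y => ‖v y‖)
        (‖v x‖⁻¹ • (innerSL ℝ (v x)).comp (fderiv ℝ v x)) x := by
      have h := (hasFDerivAt_norm_of_ne_zero hx0).comp x hvd
      rwa [ContinuousLinearMap.smul_comp] at h
    rw [Set.indicator_of_mem (show x ∈ {x | k < ‖v x‖} from hlt), hN.fderiv, norm_smul, norm_inv,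
      norm_norm]
    refine mul_le_mul_of_nonneg_right ?_ (norm_nonneg _)
    -- `k₀(v x) / √(δ² + m²) ≤ |v x|⁻¹` with `m = |v x| - k = k₀(v x) |v x| ≤ √(δ² + m²)`
    have hm0 : 0 ≤ max (‖v x‖ - k) 0 := le_max_right _ _
    have hpos : 0 < δ ^ 2 + (max (‖v x‖ - k) 0) ^ 2 := by positivity
    have hs : 0 < √(δ ^ 2 + (max (‖v x‖ - k) 0) ^ 2) := Real.sqrt_pos.2 hpos
    have hms : max (‖v x‖ - k) 0 ≤ √(δ ^ 2 + (max (‖v x‖ - k) 0) ^ 2) := le_sqrt_sq_add_sq hm0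
    have hwt : max (‖v x‖ - k) 0 / max ‖v x‖ k = max (‖v x‖ - k) 0 / ‖v x‖ := by
      rw [max_eq_left hlt.le]
    rw [hwt]
    calc max (‖v x‖ - k) 0 / ‖v x‖ / √(δ ^ 2 + (max (‖v x‖ - k) 0) ^ 2)
        = max (‖v x‖ - k) 0 / √(δ ^ 2 + (max (‖v x‖ - k) 0) ^ 2) * ‖v x‖⁻¹ := by
          rw [div_div, mul_comm ‖v x‖ _, ← div_div, div_eq_mul_inv]
      _ ≤ 1 * ‖v x‖⁻¹ :=
          mul_le_mul_of_nonneg_right (div_le_one_of_le₀ hms hs.le) (inv_nonneg.2 (norm_nonneg _))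
      _ = ‖v x‖⁻¹ := one_mul _

/-- **Stub S1 (two-level `C¹` truncation of the speed).** For a `C¹` field `v` and levels
`0 < k < h` there is a `C¹` scalar `w ≥ 0` with `w² ≤ (|v| - k)₊²`, `w ≥ (h-k)/4` on `{|v| > h}` and
`|∇w| ≤ 1_{|v|>k} |∇|v||`, namely `w = √(δ² + (|v|-k)₊²) - δ` with `δ = (h-k)/2`. -/
theorem stub_truncation :
    ∀ (v : EuclideanSpace ℝ (Fin 3) → EuclideanSpace ℝ (Fin 3)) (k h : ℝ), ContDiff ℝ 1 v →
      0 < k → k < h →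
      ∃ w : EuclideanSpace ℝ (Fin 3) → ℝ, ContDiff ℝ 1 w ∧ (∀ x, 0 ≤ w x) ∧
        (∀ x, w x ^ 2 ≤ (max (‖v x‖ - k) 0) ^ 2) ∧ (∀ x, h < ‖v x‖ → (h - k) / 4 ≤ w x) ∧
        (∀ x, ‖fderiv ℝ w x‖ ≤
          Set.indicator {x | k < ‖v x‖} (fun x => ‖fderiv ℝ (fun y => ‖v y‖) x‖) x) := by
  intro v k h hv hk hkh
  obtain ⟨δ, hδ, hδ_eq⟩ : ∃ δ : ℝ, 0 < δ ∧ h - k = 2 * δ := ⟨(h - k) / 2, by linarith, by ring⟩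
  refine ⟨fun x => √(δ ^ 2 + (max (‖v x‖ - k) 0) ^ 2) - δ, ?_, ?_, ?_, ?_, ?_⟩
  · -- `C¹`: `δ² + Ψ ∘ v` is `C¹` and positive, and `√` is smooth off `0`
    have hΨ : ContDiff ℝ 1 fun x => (max (‖v x‖ - k) 0) ^ 2 := (contDiff_one_truncSq hk).comp hv
    have hg : ContDiff ℝ 1 fun x => δ ^ 2 + (max (‖v x‖ - k) 0) ^ 2 := contDiff_const.add hΨ
    exact (hg.sqrt fun x => by positivity).sub contDiff_const
  · intro x
    exact sub_nonneg.2 (le_sqrt_sq_add δ (sq_nonneg _))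
  · intro x
    exact sq_sqrt_sq_add_sub_le hδ.le (sq_nonneg _)
  · intro x hx
    have hm : 2 * δ < max (‖v x‖ - k) 0 := lt_max_of_lt_left (by linarith)
    calc (h - k) / 4 = δ / 2 := by rw [hδ_eq]; ring
      _ ≤ √(δ ^ 2 + (max (‖v x‖ - k) 0) ^ 2) - δ := half_le_sqrt_sq_add_sub hδ hm
  · intro x
    exact norm_fderiv_trunc_le hv hk hδ x

end Summit.NavierStokesRegularity.NavierStokesRegularity.Theorems.LevelSetClosure

end
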